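/-
Copyright (c) 2026 the pub-hodgecm-mathlib formalisation cell (harness21).  Prover seat hodgecm-mathlib-K2Liu-p09 (g8), Track B «K2-LIT» ∕ hLiu418
#184♮, Road I v3, unit U5 «THE CLOSE», FACE-G (directed assembler ★ p863040, `DX` of record = single-place letters): THE INVERSE SIGN-FRAME CHART —
every single-place one-parameter subgroup `exp (sX)` of `U(J)(F ⊗ ℝ)` IS a one-place curve `placeSecJ σ (exp (sY), 1)` (★ p05 W4-iii
`K2LiuArchPlaceSecExp` run backwards).  THEOREMS ONLY.  2026-09-05.
-/
import Summits.HodgeConjecture.HodgeConjecture.Theorems.K2LiuArchPlaceSecExp       -- ★ W4-iii: the sign-frame chart in matrices, `exists_archSkew_expGL_eq_placeSecJ_expMem`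
import HarnessLib

/-!
# (FACE-G, `DX` glue) THE INVERSE CHART: a single-place arch letter `X ∈ 𝔲` supported at `w(σ)` IS a chart letter `Y ∈ 𝔲(P′,Q′)`,
# `exp (sX) = placeSecJ σ (exp (sY), 1)` for all real `s`

Track B ∕ K2-LIT, hLiu418 = stmt-HodgeConjecture-24832, #42F′ FACE-G.  The directed assembler ★ `K2LiuFaceGAssemblerDirected.faceG_of_organs_directed (DX)` owes
its letters L1∕L2 at the directions `DX` of record = SINGLE-PLACE letters («`∀ w ≠ w₀, X.map (evalC L w) = 0`», desk K2Liu-p10 (g6)).  The payers of L2 (the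
(W-orb) road (C2): ★ `K2LiuArchOrbitDerivClosure…`, (C2-B) K2E3-p31, (C2-B-top) K2Liu-p10) and of L1's section derivatives compute in the one-place JUNCTION currency
`placeSecJ σ (g, 1)`, `g ∈ U(P′,Q′)` (★ `K2LiuArchSectionPlaceJunction`), each in the sign frame of ITS datum (the small pair's lands in the frame of `a′ • hermD`,
★ P3b; the section side in that of `hermD`).  ★ W4-iii `exists_archSkew_expGL_eq_placeSecJ_expMem` gives, for every chart letter `Y`, a single-place `X` with
`exp (sX) = placeSecJ σ (exp (sY), 1)`.  THIS FILE is the CONVERSE, generic in the datum `(E, c, N, J = diag t₀ ⊗ 1, δ, σ, eP, eQ)`, so that every organ converts a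
`DX`-direction into its own chart by name:

* §1 **`coe_relabel_toUFormEquiv_archAt_expGL`** — the matrix of the chart image `u_s := relabel (toUFormEquiv (archAt (w σ) (exp (sX))))` is
  `exp (s · Ŷ)`, **`Ŷ = (diag(D_σ) · X_{w(σ)} · diag(D_σ)⁻¹)^{ê⁻¹}`** (★ `coe_toUForm`, ★ `UForm.coe_relabel`, ★ `coe_archAt_expGL_smul`, `Matrix.exp_units_conj`,
  ★ `exp_reindex`); **`reindex_scaleConj_evalC_mem_lie`** — `Ŷ ∈ 𝔲(P′,Q′)` (the `u_s` preserve `signForm`, tangent ★ `skew_of_forall_exp_conjTranspose_mul`,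
  ★ `mem_uFormGroup_lie_iff`); **`expMem_smul_eq_relabel_toUFormEquiv_archAt`** — `exp (sŶ) = u_s` in `U(P′,Q′)`.
* §2 **`expGL_eq_placeSecJ_expMem_of_single`** — for `X ∈ archSkew F E c N J` with `X_w = 0` for `w ≠ w(σ)`: `exp (sX) = placeSecJ σ (exp (sŶ), 1)` for all `s`
  (place by place: ★ `archPiEquiv` injective, ★ `archAt_archSingle_self ∕ _of_ne`, ★ `placeSecJ_inl`, ★ `placeSec_apply`); packaged
  **`exists_lie_expGL_eq_placeSecJ_expMem_of_single : ∃ Y : 𝔲(P′,Q′), ∀ s, exp (sX) = placeSecJ σ (exp (sY), 1)`** — the converse of ★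
  `exists_archSkew_expGL_eq_placeSecJ_expMem`, same equation shape.
* §3 (doubled CM frame of #41) **`exists_lie_archExp_eq_archEmb_placeSecJ_of_single`** — `archExp hX s = archEmb (placeSecJ σ (exp (sY), 1))` in `H(𝔸)` for single-place
  `X` (★ `archExp_eq_archEmb`): the `DX`-direction of F1 ED. 2 read in the (W4)∕(C2) junction currency.

HONEST LABEL: HC_CM is proved only modulo the 7 printed citations (2 remaining named inputs: hLiu418 = stmt-HodgeConjecture-24832, h413 =
stmt-HodgeConjecture-24833) until rung 0 closes; organ glue for #42F′'s FACE-G, moves no counter.  No definition, no instance, no notation, no named fact, no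
`sorry`; the Mathlib idiom `attribute [local instance 100] LieRing.ofAssociativeRing` (to name `(uFormGroup P′ Q′).lie`, as ★ W4-iii ∕ (G2-W2)).

## References
[BorelJacquet1979] A. Borel, H. Jacquet, Proc. Symp. Pure Math. 33.1 (1979), §4.1 · [Knapp2002] A. W. Knapp, *Lie Groups Beyond an Introduction* (2002), Introduction §2
Prop. 0.11, I §1, I §10 · [PlatonovRapinchuk1994] V. Platonov, A. Rapinchuk, *Algebraic Groups and Number Theory* (1994), §2.3.
-/

set_option autoImplicit false
set_option linter.dupNamespace false

noncomputable section

open scoped Classical Matrix TensorProduct SchwartzMap MatrixGroups Matrix.Norms.Operator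
open NumberField NumberField.InfinitePlace NumberField.mixedEmbedding IsDedekindDomain NormedSpace
open Literature.Analysis.SegalBargmann Literature.Analysis.Distribution
open Literature.RepresentationTheory.HeisenbergGroup
open Literature.NumberTheory.Automorphic Literature.NumberTheory.Automorphic.UnitaryGroup
open Literature.NumberTheory.Weil1964 Literature.NumberTheory.Weil1964.MpS Literature.NumberTheory.Weil1964.UnitaryWeil
open Literature.RepresentationTheory.HarrisKudlaSweet1996 Literature.NumberTheory.GaloisRepresentations
open Literature.NumberTheory.GelbartRogawski1991 Literature.NumberTheory.GelbartRogawski1991.UnitaryDualPair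
open Literature.NumberTheory.GelbartRogawski1991.UnitaryDualPair.LocalSplitting
open Literature.NumberTheory.GelbartRogawski1991.GRConstruction
open Literature.NumberTheory.K2Lit.SiegelDoubled
open Literature.RepresentationTheory.KonnoKonno2007 hiding LetterKind letterOf letterGen letterOf_boost letterOf_torus letterOf_torus_eq
  letterGen_boost letterGen_torus letterGen_mem_lie exp_smul_letterGen
open Literature.RepresentationTheory.KonnoKonno2007.RealDualPair
open Literature.Analysis.Matrix.KroneckerSum (exp_reindex)
open Summit.HodgeConjecture.HodgeConjecture.Cruxes.HLiu418.K2LiuArchSkewPlaces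
open Summit.HodgeConjecture.HodgeConjecture.Cruxes.HLiu418 (K2LiuArchOneParameterOrbitDefs.archEmb K2LiuArchOneParameterOrbitDefs.archExp
  K2LiuArchOneParameterOrbitDefs.archExp_eq_archEmb)

-- Mathlib idiom (`Mathlib/Algebra/Lie/OfAssociative.lean`), as in ★ `RealMatrixGroups` ∕ (G2-W2) ∕ ★ W4-iii: the commutator bracket on `Matrix n n ℂ`, needed to
-- name the Lie algebra `(uFormGroup P′ Q′).lie`
attribute [local instance 100] LieRing.ofAssociativeRing

/-! ## §1 The chart image of a single-place one-parameter subgroup is a one-parameter subgroup of `U(P′,Q′)` -/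

namespace Summit.HodgeConjecture.HodgeConjecture.Cruxes.HLiu418.K2LiuArchSectionPlaceBlock

section Chart

variable {F : Type} [Field F] [NumberField F] (E : Type) [Field E] [NumberField E] [Algebra F E] (c : E ≃ₐ[F] E)
  (N : ℕ) (hc : c ≠ 1)
  (wOf : {v : InfinitePlace F // v.IsReal} → {w : InfinitePlace E // w.IsComplex})
  (hw : ∀ v, c • (wOf v).1 = (wOf v).1) (t₀ : Fin N → F) (ht0 : ∀ j, t₀ j ≠ 0) {δ : E} (hcδ : c δ = -δ) (hδ : δ ≠ 0)
  (σ : {v : InfinitePlace F // v.IsReal})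
  (hover : ∀ v, (wOf v).1.comap (algebraMap F E) = v.1) {T : Matrix (Fin N) (Fin N) F} (hTd : T = Matrix.diagonal t₀)
  {J : Matrix (Fin N) (Fin N) E} (hJ : J = T.map (algebraMap F E)) (hfix : ∀ w : InfinitePlace E, c • w = w)
  {P' Q' : Type} [Fintype P'] [DecidableEq P'] [Fintype Q'] [DecidableEq Q']
  (eP : PosIdx (signVec wOf t₀ δ σ) ≃ P') (eQ : NegIdx (signVec wOf t₀ δ σ) ≃ Q')

/-- **THE CHART IMAGE OF `exp (sX)` IN MATRICES**: the matrix of `relabel eP eQ (toUFormEquiv ε_σ D_σ c_σ (archAt (w σ) (exp (sX))))` is `exp (s · Ŷ)` with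
`Ŷ = (diag(D_σ) · X_{w(σ)} · diag(D_σ)⁻¹)` reindexed by `ε_σ` and then by `eP ⊕ eQ`, `X_{w(σ)} = X.map (evalC E (w σ))` (★ `UForm.coe_relabel`, ★ `coe_toUForm`,
★ `coe_archAt_expGL_smul`; conjugation and reindexing commute with the exponential: `Matrix.exp_units_conj`, ★ `exp_reindex`).
[cite: Knapp2002, Introduction §2 Prop. 0.11] [cite: PlatonovRapinchuk1994, §2.3] -/
theorem coe_relabel_toUFormEquiv_archAt_expGL {X : Matrix (Fin N) (Fin N) (mixedSpace E)} (hX : X ∈ archSkew F E c N J) (s : ℝ) :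
    (((UForm.relabel (PosIdx (signVec wOf t₀ δ σ)) (NegIdx (signVec wOf t₀ δ σ)) P' Q' eP eQ
        (toUFormEquiv (signSplit (signVec wOf t₀ δ σ)) (sqrtAbs_signVec_ne_zero hc hw hcδ hδ ht0 σ) (deltaIm_ne_zero hc hw hcδ hδ σ)
          (formCongr_signFrame_eq E c N hc wOf hw t₀ ht0 hcδ hδ σ hover hTd hJ)
          (archAt F E c N J (wOf σ) (hfix _) hc ⟨expGL (s • X), expGL_smul_mem_arch J hX s⟩)) : UForm P' Q') :
        GL (P' ⊕ Q') ℂ) : Matrix (P' ⊕ Q') (P' ⊕ Q') ℂ) =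
      exp (s • Matrix.reindex (Equiv.sumCongr eP eQ) (Equiv.sumCongr eP eQ)
          (Matrix.reindex (signSplit (signVec wOf t₀ δ σ)) (signSplit (signVec wOf t₀ δ σ))
            (scaleConj (sqrtAbs (signVec wOf t₀ δ σ)) (X.map (evalC E (wOf σ)))))) := by
  rw [UForm.coe_relabel, toUFormEquiv_apply, coe_toUForm, coe_archAt_expGL_smul F E c N J hc (wOf σ) (hfix _) hX s]
  -- `scaleConj D (exp (s X_w)) = exp (s · scaleConj D X_w)`
  have hconj : scaleConj (sqrtAbs (signVec wOf t₀ δ σ)) (exp (s • X.map (evalC E (wOf σ)))) =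
      exp (s • scaleConj (sqrtAbs (signVec wOf t₀ δ σ)) (X.map (evalC E (wOf σ)))) := by
    rw [← scaleGL_mul_mul_inv _ (sqrtAbs_signVec_ne_zero hc hw hcδ hδ ht0 σ), ← scaleGL_mul_mul_inv _ (sqrtAbs_signVec_ne_zero hc hw hcδ hδ ht0 σ),
      ← Matrix.exp_units_conj, Matrix.mul_smul, Matrix.smul_mul]
  -- reindexing commutes with `exp` and with the scalar `s`
  rw [hconj, ← exp_reindex, ← exp_reindex]
  rfl

include hc hw ht0 hcδ hδ hover hTd hJ hfix in
/-- **`Ŷ ∈ 𝔲(P′,Q′)`**: the chart images `u_s` of `exp (sX)` lie in `U(P′,Q′)` and have matrices `exp (sŶ)`, so `Ŷᴴ D + D Ŷ = 0` for `D = signForm P′ Q′` (tangent at `s = 0`,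
★ `skew_of_forall_exp_conjTranspose_mul`; ★ `mem_uFormGroup_lie_iff`). [cite: Knapp2002, I §1] -/
theorem reindex_scaleConj_evalC_mem_lie {X : Matrix (Fin N) (Fin N) (mixedSpace E)} (hX : X ∈ archSkew F E c N J) :
    Matrix.reindex (Equiv.sumCongr eP eQ) (Equiv.sumCongr eP eQ)
          (Matrix.reindex (signSplit (signVec wOf t₀ δ σ)) (signSplit (signVec wOf t₀ δ σ))
            (scaleConj (sqrtAbs (signVec wOf t₀ δ σ)) (X.map (evalC E (wOf σ))))) ∈ (uFormGroup P' Q').lie := by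
  rw [mem_uFormGroup_lie_iff]
  refine skew_of_forall_exp_conjTranspose_mul _ _ fun s => ?_
  have hu := (mem_uFormGroup_carrier_iff (α := P') (β := Q') _).1 ((UForm.relabel (PosIdx (signVec wOf t₀ δ σ)) (NegIdx (signVec wOf t₀ δ σ)) P' Q' eP eQ
        (toUFormEquiv (signSplit (signVec wOf t₀ δ σ)) (sqrtAbs_signVec_ne_zero hc hw hcδ hδ ht0 σ) (deltaIm_ne_zero hc hw hcδ hδ σ)
          (formCongr_signFrame_eq E c N hc wOf hw t₀ ht0 hcδ hδ σ hover hTd hJ)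
          (archAt F E c N J (wOf σ) (hfix _) hc ⟨expGL (s • X), expGL_smul_mem_arch J hX s⟩)) : UForm P' Q')).2
  rw [coe_relabel_toUFormEquiv_archAt_expGL E c N hc wOf hw t₀ ht0 hcδ hδ σ hover hTd hJ hfix eP eQ hX s] at hu
  exact hu

/-- **`exp (sŶ) = u_s` IN `U(P′,Q′)`**: the one-parameter subgroup of the chart letter `Ŷ` IS the chart image of `exp (sX)` (both have matrix `exp (sŶ)`:
`coe_relabel_toUFormEquiv_archAt_expGL`, ★ `RealMatrixGroup.coe_expMem`). [cite: Knapp2002, Introduction §2 Prop. 0.11, I §10] -/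
theorem expMem_smul_eq_relabel_toUFormEquiv_archAt {X : Matrix (Fin N) (Fin N) (mixedSpace E)} (hX : X ∈ archSkew F E c N J) (s : ℝ) :
    (((uFormGroup P' Q').expMem
        ⟨((s • (⟨Matrix.reindex (Equiv.sumCongr eP eQ) (Equiv.sumCongr eP eQ)
          (Matrix.reindex (signSplit (signVec wOf t₀ δ σ)) (signSplit (signVec wOf t₀ δ σ))
            (scaleConj (sqrtAbs (signVec wOf t₀ δ σ)) (X.map (evalC E (wOf σ))))), reindex_scaleConj_evalC_mem_lie E c N hc wOf hw t₀ ht0 hcδ hδ σ hover hTd hJ hfix eP eQ hX⟩ :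
              ↥(uFormGroup P' Q').lie.toSubmodule) : ↥(uFormGroup P' Q').lie.toSubmodule) : Matrix (P' ⊕ Q') (P' ⊕ Q') ℂ),
          (s • (⟨Matrix.reindex (Equiv.sumCongr eP eQ) (Equiv.sumCongr eP eQ)
          (Matrix.reindex (signSplit (signVec wOf t₀ δ σ)) (signSplit (signVec wOf t₀ δ σ))
            (scaleConj (sqrtAbs (signVec wOf t₀ δ σ)) (X.map (evalC E (wOf σ))))), reindex_scaleConj_evalC_mem_lie E c N hc wOf hw t₀ ht0 hcδ hδ σ hover hTd hJ hfix eP eQ hX⟩ :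
              ↥(uFormGroup P' Q').lie.toSubmodule)).2⟩ : UForm P' Q')) =
      UForm.relabel (PosIdx (signVec wOf t₀ δ σ)) (NegIdx (signVec wOf t₀ δ σ)) P' Q' eP eQ
        (toUFormEquiv (signSplit (signVec wOf t₀ δ σ)) (sqrtAbs_signVec_ne_zero hc hw hcδ hδ ht0 σ) (deltaIm_ne_zero hc hw hcδ hδ σ)
          (formCongr_signFrame_eq E c N hc wOf hw t₀ ht0 hcδ hδ σ hover hTd hJ)
          (archAt F E c N J (wOf σ) (hfix _) hc ⟨expGL (s • X), expGL_smul_mem_arch J hX s⟩)) := by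
  refine Subtype.ext (Units.ext ?_)
  rw [coe_relabel_toUFormEquiv_archAt_expGL E c N hc wOf hw t₀ ht0 hcδ hδ σ hover hTd hJ hfix eP eQ hX s]
  show ((((uFormGroup P' Q').expMem _ : UForm P' Q') : GL (P' ⊕ Q') ℂ) : Matrix (P' ⊕ Q') (P' ⊕ Q') ℂ) = _
  rw [RealMatrixGroup.coe_expMem, coe_expGL, Submodule.coe_smul]

/-! ## §2 `exp (sX) = placeSecJ σ (exp (sŶ), 1)` for a single-place letter `X` -/

/-- **THE INVERSE CHART**: for `X ∈ 𝔲 = archSkew F E c N J` SUPPORTED AT `w(σ)` (`X_w = 0` for `w ≠ w(σ)`), the one-parameter subgroup `exp (sX)` of `U(J)(F ⊗ ℝ)` is the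
one-place curve of the chart letter `Ŷ`: `exp (sX) = placeSecJ σ (exp (sŶ), 1)` for every real `s` (place by place: ★ `archPiEquiv` is injective; at `w(σ)` ★
`archAt_archSingle_self` and §1; at `w ≠ w(σ)` both components are `1`, ★ `archAt_archSingle_of_ne`, `exp 0 = 1`). [cite: BorelJacquet1979, §4.1]
[cite: Knapp2002, Introduction §2 Prop. 0.11] -/
theorem expGL_eq_placeSecJ_expMem_of_single {X : Matrix (Fin N) (Fin N) (mixedSpace E)} (hX : X ∈ archSkew F E c N J)
    (hXw : ∀ w : {w : InfinitePlace E // w.IsComplex}, w ≠ wOf σ → X.map (evalC E w) = 0) (s : ℝ) :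
    (⟨expGL (s • X), expGL_smul_mem_arch J hX s⟩ : UnitaryGroup.arch F E c N J) =
      placeSecJ E c N hc wOf hw t₀ ht0 hcδ hδ σ hover hTd hJ hfix eP eQ
        (((((uFormGroup P' Q').expMem
          ⟨((s • (⟨Matrix.reindex (Equiv.sumCongr eP eQ) (Equiv.sumCongr eP eQ)
          (Matrix.reindex (signSplit (signVec wOf t₀ δ σ)) (signSplit (signVec wOf t₀ δ σ))
            (scaleConj (sqrtAbs (signVec wOf t₀ δ σ)) (X.map (evalC E (wOf σ))))), reindex_scaleConj_evalC_mem_lie E c N hc wOf hw t₀ ht0 hcδ hδ σ hover hTd hJ hfix eP eQ hX⟩ :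
                ↥(uFormGroup P' Q').lie.toSubmodule) : ↥(uFormGroup P' Q').lie.toSubmodule) : Matrix (P' ⊕ Q') (P' ⊕ Q') ℂ),
            (s • (⟨Matrix.reindex (Equiv.sumCongr eP eQ) (Equiv.sumCongr eP eQ)
          (Matrix.reindex (signSplit (signVec wOf t₀ δ σ)) (signSplit (signVec wOf t₀ δ σ))
            (scaleConj (sqrtAbs (signVec wOf t₀ δ σ)) (X.map (evalC E (wOf σ))))), reindex_scaleConj_evalC_mem_lie E c N hc wOf hw t₀ ht0 hcδ hδ σ hover hTd hJ hfix eP eQ hX⟩ :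
                ↥(uFormGroup P' Q').lie.toSubmodule)).2⟩ : UForm P' Q')), (1 : UForm Unit Empty)) : Ginf P' Q' Unit Empty) := by
  rw [expMem_smul_eq_relabel_toUFormEquiv_archAt E c N hc wOf hw t₀ ht0 hcδ hδ σ hover hTd hJ hfix eP eQ hX s, placeSecJ_inl, placeSec_apply,
    ContinuousMulEquiv.symm_apply_apply, ContinuousMulEquiv.symm_apply_apply]
  apply (archPiEquiv F E c N J hc hfix).injective
  funext w
  rw [archPiEquiv_apply, archPiEquiv_apply]
  by_cases hw' : w = wOf σ
  · subst hw'
    rw [archAt_archSingle_self]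
  · rw [archAt_archSingle_of_ne F E c N J hc hfix (wOf σ) hw']
    refine Subtype.ext (Units.ext ?_)
    rw [coe_archAt_expGL_smul F E c N J hc w (hfix _) hX s, hXw w hw', smul_zero, NormedSpace.exp_zero]
    rfl

/-- **THE INVERSE CHART, PACKAGED** — the converse of ★ `exists_archSkew_expGL_eq_placeSecJ_expMem`, same equation: for a single-place `X ∈ 𝔲` supported at `w(σ)` there
is `Y ∈ 𝔲(P′,Q′)` with `exp (sX) = placeSecJ σ (exp (sY), 1)` for all real `s`. [cite: BorelJacquet1979, §4.1] [cite: Knapp2002, Introduction §2 Prop. 0.11] -/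
theorem exists_lie_expGL_eq_placeSecJ_expMem_of_single {X : Matrix (Fin N) (Fin N) (mixedSpace E)} (hX : X ∈ archSkew F E c N J)
    (hXw : ∀ w : {w : InfinitePlace E // w.IsComplex}, w ≠ wOf σ → X.map (evalC E w) = 0) :
    ∃ Y : ↥(uFormGroup P' Q').lie.toSubmodule, ∀ s : ℝ,
      (⟨expGL (s • X), expGL_smul_mem_arch J hX s⟩ : UnitaryGroup.arch F E c N J) =
        placeSecJ E c N hc wOf hw t₀ ht0 hcδ hδ σ hover hTd hJ hfix eP eQ
          (((((uFormGroup P' Q').expMem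
          ⟨((s • Y : ↥(uFormGroup P' Q').lie.toSubmodule) : Matrix (P' ⊕ Q') (P' ⊕ Q') ℂ), (s • Y).2⟩ : UForm P' Q')), (1 : UForm Unit Empty)) :
            Ginf P' Q' Unit Empty) :=
  ⟨⟨Matrix.reindex (Equiv.sumCongr eP eQ) (Equiv.sumCongr eP eQ)
          (Matrix.reindex (signSplit (signVec wOf t₀ δ σ)) (signSplit (signVec wOf t₀ δ σ))
            (scaleConj (sqrtAbs (signVec wOf t₀ δ σ)) (X.map (evalC E (wOf σ))))), reindex_scaleConj_evalC_mem_lie E c N hc wOf hw t₀ ht0 hcδ hδ σ hover hTd hJ hfix eP eQ hX⟩,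
    fun s => expGL_eq_placeSecJ_expMem_of_single E c N hc wOf hw t₀ ht0 hcδ hδ σ hover hTd hJ hfix eP eQ hX hXw s⟩

end Chart

end Summit.HodgeConjecture.HodgeConjecture.Cruxes.HLiu418.K2LiuArchSectionPlaceBlock

/-! ## §3 The doubled CM frame of #41: `archExp hX s = archEmb (placeSecJ σ (exp (sY), 1))` for single-place `X` -/

namespace Summit.HodgeConjecture.HodgeConjecture.Cruxes.HLiu418.K2LiuSwSectionArchOrbit

open Summit.HodgeConjecture.HodgeConjecture.Cruxes.HLiu418.K2LiuArchSectionPlaceBlock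

-- the doubled CM sign frame elaborates slowly (cf. ★ W4-iii)
set_option maxHeartbeats 2000000

variable (L : Type) [Field L] [NumberField L] [IsCMField L]

variable {N M n : ℕ} (e : Fin N × Fin M ≃ Fin n)
  (dV : Fin N → L) (hdV : ∀ i, IsCMField.complexConj L (dV i) = dV i) (hdV0 : ∀ i, dV i ≠ 0)
  (dW : Fin M → L) (hdW : ∀ i, IsCMField.complexConj L (dW i) = dW i) (hdW0 : ∀ i, dW i ≠ 0)
  (σ : {v : InfinitePlace (Fp L) // v.IsReal})
  (e₂P : PosIdx (signVec (cmPlaceOver L)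
      (fun k => Sum.elim (cmGramEntry L e dV hdV dW hdW) (-cmGramEntry L e dV hdV dW hdW) ((LocalSplitting.e₂ n).symm k)) (imagUnit L) σ) ≃ Fin 2)
  (e₂Q : NegIdx (signVec (cmPlaceOver L)
      (fun k => Sum.elim (cmGramEntry L e dV hdV dW hdW) (-cmGramEntry L e dV hdV dW hdW) ((LocalSplitting.e₂ n).symm k)) (imagUnit L) σ) ≃ Fin 2)

include hdV0 hdW0 in
/-- **`archExp hX s = archEmb (placeSecJ σ (exp (sY), 1))` IN `H(𝔸)` FOR A SINGLE-PLACE `X`**: a direction `X ∈ archSkew` of the doubled group `H = U(hermD)` of the `DX` class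
of record (supported at the real place `σ`: `X_w = 0` for `w ≠ w(σ)`) is, along its one-parameter orbit ★ `archExp hX`, the one-place curve of a chart letter
`Y ∈ 𝔲(2,2)` (§2 + ★ `archExp_eq_archEmb`) — the converse of ★ W4-iii `exists_archSkew_archExp_eq_placeSecJ_expMem`. [cite: BorelJacquet1979, §4.1]
[cite: Knapp2002, Introduction §2 Prop. 0.11] -/
theorem exists_lie_archExp_eq_archEmb_placeSecJ_of_single {X : Matrix (Fin (n + n)) (Fin (n + n)) (mixedSpace L)}
    (hX : X ∈ archSkew (Fp L) L (IsCMField.complexConj L) (n + n) (hermD L e dV hdV dW hdW))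
    (hXw : ∀ w : {w : InfinitePlace L // w.IsComplex}, w ≠ cmPlaceOver L σ → X.map (evalC L w) = 0) :
    ∃ Y : ↥(uFormGroup (Fin 2) (Fin 2)).lie.toSubmodule,
      ∀ s : ℝ, K2LiuArchOneParameterOrbitDefs.archExp (Fp L) L (IsCMField.complexConj L) (n + n) (hermD L e dV hdV dW hdW) hX s =
        K2LiuArchOneParameterOrbitDefs.archEmb (Fp L) L (IsCMField.complexConj L) (n + n) (hermD L e dV hdV dW hdW)
          (placeSecJ L (IsCMField.complexConj L) (n + n) (IsCMField.complexConj_ne_one L) (cmPlaceOver L) (cmPlaceOver_smul L) _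
            (gramD_gram_realDiagonal_entry_ne_zero L e dV hdV dW hdW hdV0 hdW0) (complexConj_imagUnit L) (imagUnit_ne_zero L) σ
            (cmPlaceOver_comap L) (gramD_eq_diagonal_cm L e dV hdV dW hdW) (J := hermD L e dV hdV dW hdW) rfl
            (complexConj_smul_infinitePlace L) e₂P e₂Q
            ((((uFormGroup (Fin 2) (Fin 2)).expMem
                ⟨((s • Y : ↥(uFormGroup (Fin 2) (Fin 2)).lie.toSubmodule) : Matrix (Fin 2 ⊕ Fin 2) (Fin 2 ⊕ Fin 2) ℂ), (s • Y).2⟩ :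
                UForm (Fin 2) (Fin 2)), (1 : UForm Unit Empty)) : Ginf (Fin 2) (Fin 2) Unit Empty)) := by
  obtain ⟨Y, hY⟩ := exists_lie_expGL_eq_placeSecJ_expMem_of_single L (IsCMField.complexConj L) (n + n) (IsCMField.complexConj_ne_one L)
    (cmPlaceOver L) (cmPlaceOver_smul L) _ (gramD_gram_realDiagonal_entry_ne_zero L e dV hdV dW hdW hdV0 hdW0) (complexConj_imagUnit L) (imagUnit_ne_zero L) σ
    (cmPlaceOver_comap L) (gramD_eq_diagonal_cm L e dV hdV dW hdW) (J := hermD L e dV hdV dW hdW) rfl (complexConj_smul_infinitePlace L) e₂P e₂Q hX hXw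
  exact ⟨Y, fun s => by rw [K2LiuArchOneParameterOrbitDefs.archExp_eq_archEmb, hY s]⟩

end Summit.HodgeConjecture.HodgeConjecture.Cruxes.HLiu418.K2LiuSwSectionArchOrbit

end
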